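import Summits.ResolutionOfSingularities.ResolutionOfSingularities.Theorems.RisoStrataRtdUpperSemicontinuousEdim
import Summits.ResolutionOfSingularities.ResolutionOfSingularities.Theorems.RisoStrataRisoCurvesHahn
import Summits.ResolutionOfSingularities.ResolutionOfSingularities.Theorems.RisoStrataDefs

/-!
# Route RisoStrata — crux `RisoCentresResolve` (stmt-ResolutionOfSingularities-18546), line `Sketch`:
# the hidden lemma `Rtd B m r → r ≤ trdeg_k K ≤ N`

The typed riso-triviality dimension of the route (the inline `Rtd` of the Theses file: a
presentation `g` of `B` by generators in `m`, a `k`-subspace `W ≤ kⁿ` of dimension `≥ r`, and a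
straightener `φ` of the Hahn-series arcs at `m` whose image is invariant under `W`-translations of
positive order) is bounded by the TRANSCENDENCE DEGREE: this is the "hidden lemma" every refuter
pass recorded on the crux (Monreal, arXiv:2606.12554, Thm. 1.2 `rtd_x ≤ dim_x X`, for the route's
encoding), and it is what makes the cut letters `d ≥ N` of a schedule blow up the whole reduced
singular locus (`Cen(B, d) = ⋂ {singular maximal ideals}`).

* `hidden_rtd_le` — if some arc kills `m`, every `e + 1` elements of `B` are algebraically
  dependent over the infinite field `k`, and `Rtd B m r`, then `r ≤ e`. Mechanism: translating the
  base arc by `t·u`, `u ∈ W`, gives arcs `b_u` with `b_u(gᵢ) = uᵢ t + O(t^{>1})`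
  (the route's rv-clause (1), exactly as in `rtd_le_of_span_sup_sq_eq`); `e + 1` independent
  directions of `W` and a retraction `L : kⁿ → k^{e+1}` give elements `y_j = Σ L_{ji} gᵢ ∈ B` with
  `b_u(y_j) = (L u)_j t + O(t^{>1})`; an algebraic relation `P(y) = 0`, read in its initial degree
  (`coeff_aeval_eq_eval_homogeneousComponent`), forces the lowest homogeneous component of `P` to
  vanish on all of `k^{e+1}`, hence to be `0` (`MvPolynomial.funext`).
* `hidden_trdeg` — for a presentation `K = k(hᵢ/hⱼ)` by `N + 1` nonzero elements, every `N + 1`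
  elements of `K` are algebraically dependent over `k` (`trdeg_k K ≤ N`).
* `hidden_not_rtd_succ` — hence `¬ Rtd B m (N + 1)` for every `k`-subalgebra `B ⊆ K` and every
  maximal ideal `m` of `B` (`k` algebraically closed): the cut predicate of the route holds at
  every maximal ideal for every letter `d ≥ N`, and `risoCen_eq_of_le` records that the centre of
  such a letter is the intersection of ALL singular maximal ideals.

No definitions, no named facts.
-/

noncomputable section

set_option linter.dupNamespace false -- mandated namespace of this single-conjunct summit

namespace Summit.ResolutionOfSingularities.ResolutionOfSingularities.Theorems

open Summit.ResolutionOfSingularities.ResolutionOfSingularities.Theses.RisoStrata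

/-! ## The bound by algebraic dependence -/

section RtdLe

variable {k K : Type} [Field k] [Infinite k] [Field K] [Algebra k K]

omit [Infinite k] in
/-- A Hahn series `C c * x` has order at least that of `x` (version without `Infinite`). [folklore] -/
theorem hidden_le_orderTop_C_mul (c : k) (x : HahnSeries ℚ k) :
    x.orderTop ≤ (HahnSeries.C c * x).orderTop := by
  by_cases hc : c = 0
  · simp [hc]
  · have h0 : (0 : WithTop ℚ) ≤ (HahnSeries.C c).orderTop := by
      rw [HahnSeries.C_apply, HahnSeries.orderTop_single hc]
      exact le_rfl
    have h1 : (0 : WithTop ℚ) + x.orderTop ≤ (HahnSeries.C c).orderTop + x.orderTop :=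
      add_le_add h0 le_rfl
    rw [zero_add] at h1
    exact h1.trans HahnSeries.orderTop_add_le_mul

/-- **The hidden lemma, abstract form.** Let `B ⊆ K` be a `k`-subalgebra, `m` an ideal of `B`
killed by some `k`-algebra map `B → k⟦t^ℚ⟧` (an arc centred at `m`; for a maximal ideal of a
finitely generated `B` over an algebraically closed `k`, the evaluation map), and suppose every
`e + 1` elements of `B` are algebraically dependent over `k`. If `Rtd B m r` holds (let-expanded
verbatim from the route file), then `r ≤ e`. [folklore] -/
theorem hidden_rtd_le (B : Subalgebra k K) (m : Ideal ↥B) (e r : ℕ)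
    (hdep : ∀ y : Fin (e + 1) → ↥B, ¬ AlgebraicIndependent k y)
    (hArc : ∃ a : ↥B →ₐ[k] HahnSeries ℚ k, ∀ b ∈ m, a b = 0)
    (hRtd : ∃ (n : ℕ) (g : Fin n → ↥B), (∀ i, g i ∈ m) ∧
      Algebra.adjoin k (Set.range fun i => (g i : K)) = B ∧
      ∃ W : Submodule k (Fin n → k), r ≤ Module.finrank k ↥W ∧
        ∃ φ : {α : ↥B →ₐ[k] HahnSeries ℚ k // ∀ b ∈ m, 0 < (α b).orderTop} →
            (Fin n → HahnSeries ℚ k),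
          (∀ a b : {α : ↥B →ₐ[k] HahnSeries ℚ k // ∀ b ∈ m, 0 < (α b).orderTop}, a ≠ b →
              ∃ j, ∀ i, (a.1 (g j) - b.1 (g j)).orderTop <
                ((φ a i - φ b i) - (a.1 (g i) - b.1 (g i))).orderTop) ∧
          (∀ a i, 0 < (φ a i).orderTop) ∧
          (∀ a, ∀ w : Fin n → HahnSeries ℚ k, (∀ i, 0 < (w i).orderTop) →
              w ∈ Submodule.span (HahnSeries ℚ k)
                ((fun u : Fin n → k => fun i => HahnSeries.C (u i)) '' (W : Set (Fin n → k))) →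
                ∃ b, φ b = φ a + w)) :
    r ≤ e := by
  classical
  obtain ⟨n, g, hg, _, W, hrW, φ, hrv, _, htr⟩ := hRtd
  obtain ⟨a, ha⟩ := hArc
  by_contra hre
  rw [not_le] at hre
  -- the base arc
  let a₀ : {α : ↥B →ₐ[k] HahnSeries ℚ k // ∀ b ∈ m, 0 < (α b).orderTop} :=
    ⟨a, fun b hb => by rw [ha b hb, HahnSeries.orderTop_zero]; exact WithTop.top_pos⟩
  have ha₀g : ∀ i, a₀.1 (g i) = 0 := fun i => ha _ (hg i)
  -- key: translating the base arc by `t • u`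
  have key : ∀ u ∈ W, ∃ b : {α : ↥B →ₐ[k] HahnSeries ℚ k // ∀ b ∈ m, 0 < (α b).orderTop},
      ∀ i, (1 : WithTop ℚ) < (HahnSeries.single (1 : ℚ) (u i) - b.1 (g i)).orderTop := by
    intro u hu
    let w : Fin n → HahnSeries ℚ k := fun i => HahnSeries.single (1 : ℚ) (u i)
    have hw1 : ∀ i, 0 < (w i).orderTop := fun i =>
      HahnSeries.lt_orderTop_single (by norm_num : (0 : ℚ) < 1)
    have hw2 : w ∈ Submodule.span (HahnSeries ℚ k)
        ((fun u : Fin n → k => fun i => HahnSeries.C (u i)) '' (W : Set (Fin n → k))) := by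
      have hw : w = (HahnSeries.single (1 : ℚ) (1 : k)) • (fun i => HahnSeries.C (u i)) := by
        funext i
        simp only [w, Pi.smul_apply, smul_eq_mul, HahnSeries.C_apply, HahnSeries.single_mul_single,
          add_zero, one_mul]
      rw [hw]
      exact Submodule.smul_mem _ _ (Submodule.subset_span ⟨u, hu, rfl⟩)
    obtain ⟨b, hb⟩ := htr a₀ w hw1 hw2
    refine ⟨b, ?_⟩
    by_cases hba : b = a₀
    · have hw0 : w = 0 := by rw [hba] at hb; exact left_eq_add.mp hb
      intro i
      have hwi : HahnSeries.single (1 : ℚ) (u i) = 0 := congr_fun hw0 i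
      rw [hwi, hba, ha₀g i, sub_zero, HahnSeries.orderTop_zero]
      exact WithTop.coe_lt_top 1
    · obtain ⟨j, hj⟩ := hrv b a₀ hba
      have hj' : ∀ i, (b.1 (g j)).orderTop < (w i - b.1 (g i)).orderTop := by
        intro i
        have := hj i
        rwa [ha₀g, ha₀g, sub_zero, sub_zero, hb, Pi.add_apply, add_sub_cancel_left] at this
      have h1 : (w j).orderTop = (b.1 (g j)).orderTop := by
        have := HahnSeries.orderTop_add_eq_left (hj' j)
        rwa [add_sub_cancel] at this
      have h2 : (b.1 (g j)).orderTop < ⊤ := lt_of_lt_of_le (hj' j) le_top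
      have h3 : u j ≠ 0 := by
        intro h0
        apply h2.ne
        rw [← h1]
        simp [w, h0]
      have h4 : (b.1 (g j)).orderTop = 1 := by rw [← h1]; exact HahnSeries.orderTop_single h3
      intro i
      have := hj' i
      rwa [h4] at this
  -- consequences for such an arc `b`: order `≥ 1` and degree-one coefficient `uᵢ` on `gᵢ`
  have hge1 : ∀ (u : Fin n → k) (b : {α : ↥B →ₐ[k] HahnSeries ℚ k // ∀ b ∈ m, 0 < (α b).orderTop}),
      (∀ i, (1 : WithTop ℚ) < (HahnSeries.single (1 : ℚ) (u i) - b.1 (g i)).orderTop) →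
      ∀ i, (1 : WithTop ℚ) ≤ (b.1 (g i)).orderTop := by
    intro u b hb i
    have h1 : ((1 : ℚ) : WithTop ℚ) ≤ (HahnSeries.single (1 : ℚ) (u i)).orderTop :=
      HahnSeries.orderTop_single_le
    have := HahnSeries.min_orderTop_le_orderTop_sub (x := HahnSeries.single (1 : ℚ) (u i))
      (y := HahnSeries.single (1 : ℚ) (u i) - b.1 (g i))
    rw [sub_sub_cancel] at this
    exact le_trans (le_min h1 (hb i).le) this
  have hcoeffg : ∀ (u : Fin n → k)
      (b : {α : ↥B →ₐ[k] HahnSeries ℚ k // ∀ b ∈ m, 0 < (α b).orderTop}),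
      (∀ i, (1 : WithTop ℚ) < (HahnSeries.single (1 : ℚ) (u i) - b.1 (g i)).orderTop) →
      ∀ i, (b.1 (g i)).coeff 1 = u i := by
    intro u b hb i
    have := HahnSeries.coeff_eq_zero_of_lt_orderTop (hb i)
    rw [HahnSeries.coeff_sub, HahnSeries.coeff_single_same, sub_eq_zero] at this
    exact this.symm
  -- `e + 1` independent directions in `W` and a retraction `L`
  have hfin : e + 1 ≤ Module.finrank k ↥W := by omega
  let bW := Module.finBasis k ↥W
  let V : Fin (e + 1) → (Fin n → k) := fun j => (bW (Fin.castLE hfin j) : ↥W)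
  have hVW : ∀ j, V j ∈ W := fun j => (bW (Fin.castLE hfin j)).2
  have hVli : LinearIndependent k V := by
    have h1 : LinearIndependent k (fun j : Fin (e + 1) => bW (Fin.castLE hfin j)) :=
      bW.linearIndependent.comp _ (Fin.castLE_injective hfin)
    exact h1.map' W.subtype (Submodule.ker_subtype W)
  -- the linear map `c ↦ Σ c_j V_j` and a left inverse `L`
  let f : (Fin (e + 1) → k) →ₗ[k] (Fin n → k) := Fintype.linearCombination k V
  have hf : ∀ c, f c = ∑ j, c j • V j := fun c => Fintype.linearCombination_apply k V c
  have hfinj : LinearMap.ker f = ⊥ :=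
    LinearMap.ker_eq_bot.mpr hVli.fintypeLinearCombination_injective
  obtain ⟨L, hL⟩ := f.exists_leftInverse_of_injective hfinj
  have hLf : ∀ c, L (f c) = c := fun c => by
    have := LinearMap.congr_fun hL c
    simpa using this
  -- the elements `y_j := Σ_i L(e_i)_j • g_i`
  let Lm : Fin (e + 1) → Fin n → k := fun j i => L (Pi.single i 1) j
  have hLapply : ∀ (v : Fin n → k) (j : Fin (e + 1)), L v j = ∑ i, Lm j i * v i := by
    intro v j
    have hv : v = ∑ i, v i • (Pi.single i 1 : Fin n → k) := by
      ext l; simp [Finset.sum_apply, Pi.single_apply]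
    conv_lhs => rw [hv]
    rw [map_sum, Finset.sum_apply]
    refine Finset.sum_congr rfl fun i _ => ?_
    rw [map_smul, Pi.smul_apply, smul_eq_mul, mul_comm]
  let y : Fin (e + 1) → ↥B := fun j => ∑ i, algebraMap k ↥B (Lm j i) * g i
  -- an algebraic relation among the `y_j`
  have hdep' := hdep y
  rw [algebraicIndependent_iff] at hdep'
  push Not at hdep'
  obtain ⟨P, hP0, hPne⟩ := hdep'
  -- the lowest degree `d₀` of `P` and its homogeneous component
  have hsupp : P.support.Nonempty := MvPolynomial.support_nonempty.mpr hPne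
  let d₀ : ℕ := (P.support.image Finsupp.degree).min' (hsupp.image _)
  have hd₀ : ∀ d ∈ P.support, d₀ ≤ d.degree := fun d hd =>
    Finset.min'_le _ _ (Finset.mem_image_of_mem _ hd)
  have hQne : MvPolynomial.homogeneousComponent d₀ P ≠ 0 := by
    obtain ⟨dd, hdd, hdeg⟩ : ∃ dd ∈ P.support, dd.degree = d₀ := by
      have := Finset.min'_mem _ (hsupp.image Finsupp.degree)
      obtain ⟨dd, hdd, h⟩ := Finset.mem_image.mp this
      exact ⟨dd, hdd, h⟩
    intro h0
    have := congrArg (MvPolynomial.coeff dd) h0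
    rw [MvPolynomial.coeff_homogeneousComponent, if_pos hdeg, MvPolynomial.coeff_zero] at this
    exact (MvPolynomial.mem_support_iff.mp hdd) this
  -- the lowest component vanishes everywhere
  have hQeval : ∀ c : Fin (e + 1) → k,
      MvPolynomial.eval c (MvPolynomial.homogeneousComponent d₀ P) = 0 := by
    intro c
    -- the direction `u := Σ c_j V_j ∈ W` and its arc
    let u : Fin n → k := f c
    have hu : u ∈ W := by
      rw [show u = ∑ j, c j • V j from hf c]
      exact W.sum_mem fun j _ => W.smul_mem _ (hVW j)
    obtain ⟨b, hb⟩ := key u hu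
    -- the Hahn series `z_j := b (y_j)` : order `≥ 1`, degree-one coefficient `c_j`
    let z : Fin (e + 1) → HahnSeries ℚ k := fun j => b.1 (y j)
    have hz1 : ∀ j, ((1 : ℚ) : WithTop ℚ) ≤ (z j).orderTop := by
      intro j
      change ((1 : ℚ) : WithTop ℚ) ≤ (b.1 (∑ i, algebraMap k ↥B (Lm j i) * g i)).orderTop
      rw [map_sum]
      refine le_orderTop_sum _ _ fun i _ => ?_
      rw [map_mul, algHom_algebraMap_eq_C]
      exact le_trans (by exact_mod_cast hge1 u b hb i) (hidden_le_orderTop_C_mul _ _)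
    have hzc : ∀ j, (z j).coeff 1 = c j := by
      intro j
      change (b.1 (∑ i, algebraMap k ↥B (Lm j i) * g i)).coeff 1 = c j
      rw [map_sum, HahnSeries.coeff_sum]
      have : ∀ i, (b.1 (algebraMap k ↥B (Lm j i) * g i)).coeff 1 = Lm j i * u i := by
        intro i
        rw [map_mul, algHom_algebraMap_eq_C, coeff_C_mul, hcoeffg u b hb i]
      simp_rw [this]
      rw [← hLapply u j]
      exact congr_fun (hLf c) j
    -- read the relation `P(z) = b(P(y)) = 0` in degree `d₀`
    have hPz : MvPolynomial.aeval z P = 0 := by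
      have : MvPolynomial.aeval z P = b.1 (MvPolynomial.aeval y P) := by
        rw [← AlgHom.comp_apply, MvPolynomial.comp_aeval]
      rw [this, hP0, map_zero]
    have := coeff_aeval_eq_eval_homogeneousComponent P z (γ := 1) one_pos hz1 d₀ hd₀
    rw [hPz, HahnSeries.coeff_zero] at this
    have hfun : (fun l => (z l).coeff 1) = c := funext hzc
    rw [hfun] at this
    exact this.symm
  exact hQne (MvPolynomial.funext fun c => by rw [hQeval c, map_zero])

end RtdLe

/-! ## Transcendence degree of a presentation -/

section Trdeg

open Cardinal

/-- **`trdeg_k K ≤ N` for a presentation by `N + 1` ratios**: if `K` is generated over `k` by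
the ratios `hᵢ/hⱼ` of `N + 1` nonzero elements, then every `N + 1` elements of `K` are
algebraically dependent over `k` (`K` is algebraic over `k[h₁/h₀, …, h_N/h₀]`). [folklore] -/
theorem hidden_not_algebraicIndependent {k K : Type} [Field k] [Field K] [Algebra k K] (N : ℕ)
    (h : Fin (N + 1) → K) (hh : ∀ i, h i ≠ 0)
    (hgen : IntermediateField.adjoin k
      (Set.range fun ij : Fin (N + 1) × Fin (N + 1) => h ij.1 * (h ij.2)⁻¹) = ⊤)
    (y : Fin (N + 1) → K) : ¬ AlgebraicIndependent k y := by
  intro hy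
  let s₀ : Set K := Set.range fun i : Fin N => h i.succ * (h 0)⁻¹
  have hmem : ∀ i : Fin (N + 1), h i * (h 0)⁻¹ ∈ IntermediateField.adjoin k s₀ := by
    intro i
    refine Fin.cases ?_ (fun i => ?_) i
    · rw [mul_inv_cancel₀ (hh 0)]; exact one_mem _
    · exact IntermediateField.subset_adjoin _ _ ⟨i, rfl⟩
  have hs₀ : IntermediateField.adjoin k s₀ = ⊤ := by
    rw [eq_top_iff, ← hgen]
    refine IntermediateField.adjoin_le_iff.mpr ?_
    rintro _ ⟨⟨a, b⟩, rfl⟩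
    have : h a * (h b)⁻¹ = (h a * (h 0)⁻¹) * (h b * (h 0)⁻¹)⁻¹ := by
      field_simp [hh 0, hh b]
    show h a * (h b)⁻¹ ∈ IntermediateField.adjoin k s₀
    rw [this]
    exact mul_mem (hmem a) (inv_mem (hmem b))
  haveI : Algebra.IsAlgebraic (IntermediateField.adjoin k s₀) K :=
    ⟨fun x => by
      have hx : x ∈ IntermediateField.adjoin k s₀ := by rw [hs₀]; exact IntermediateField.mem_top
      exact isAlgebraic_algebraMap (⟨x, hx⟩ : IntermediateField.adjoin k s₀)⟩
  haveI : Algebra.IsAlgebraic (Algebra.adjoin k s₀) K :=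
    IntermediateField.isAlgebraic_adjoin_iff_top.mp inferInstance
  have h1 : Algebra.trdeg k K ≤ #s₀ := Algebra.IsAlgebraic.trdeg_le_cardinalMk k s₀
  have h2 : #s₀ ≤ (N : Cardinal) := by
    refine Cardinal.mk_range_le.trans ?_
    rw [Cardinal.mk_fin]
  have h3 := hy.cardinalMk_le_trdeg
  rw [Cardinal.mk_fin] at h3
  have : ((N + 1 : ℕ) : Cardinal) ≤ (N : Cardinal) := h3.trans (h1.trans h2)
  have := Nat.cast_le.mp this
  omega

end Trdeg

/-! ## The hidden lemma for the route: no maximal ideal has `Rtd ≥ N + 1` -/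

section Route

/-- **The cut predicate holds at every maximal ideal for every letter `d ≥ N`.** For a
presentation `K = k(hᵢ/hⱼ)` by `N + 1` nonzero elements over an algebraically closed `k`, every
`k`-subalgebra `B ⊆ K`, every maximal ideal `m` of `B` and every `d ≥ N`, the route's cut
`¬ Rtd B m (d + 1)` holds (let-expanded): a witness of `Rtd` presents `B` finitely, the evaluation
at the `k`-rational point `m` is an arc killing `m`, `N + 1` elements of `B ⊆ K` are algebraically
dependent, and `hidden_rtd_le` gives `d + 1 ≤ N`. [folklore] -/
theorem hidden_cut_of_le {k K : Type} [Field k] [IsAlgClosed k] [Field K] [Algebra k K]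
    (N : ℕ) (h : Fin (N + 1) → K) (hh : ∀ i, h i ≠ 0)
    (hgen : IntermediateField.adjoin k
      (Set.range fun ij : Fin (N + 1) × Fin (N + 1) => h ij.1 * (h ij.2)⁻¹) = ⊤)
    (B : Subalgebra k K) (m : Ideal ↥B) (hm : m.IsMaximal) {d : ℕ} (hd : N ≤ d) :
    (fun (B : Subalgebra k K) (m : Ideal ↥B) (d : ℕ) => ¬ ∃ (n : ℕ) (g : Fin n → ↥B),
        (∀ i, g i ∈ m) ∧ Algebra.adjoin k (Set.range fun i => (g i : K)) = B ∧
        ∃ W : Submodule k (Fin n → k), d + 1 ≤ Module.finrank k ↥W ∧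
        ∃ φ : {α : ↥B →ₐ[k] HahnSeries ℚ k // ∀ b ∈ m, 0 < (α b).orderTop} → (Fin n → HahnSeries ℚ k),
          (∀ a b : {α : ↥B →ₐ[k] HahnSeries ℚ k // ∀ b ∈ m, 0 < (α b).orderTop}, a ≠ b →
            ∃ j, ∀ i, (a.1 (g j) - b.1 (g j)).orderTop <
              ((φ a i - φ b i) - (a.1 (g i) - b.1 (g i))).orderTop) ∧
          (∀ a i, 0 < (φ a i).orderTop) ∧
          (∀ a, ∀ w : Fin n → HahnSeries ℚ k, (∀ i, 0 < (w i).orderTop) →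
            w ∈ Submodule.span (HahnSeries ℚ k)
              ((fun u : Fin n → k => fun i => HahnSeries.C (u i)) '' (W : Set (Fin n → k))) →
              ∃ b, φ b = φ a + w)) B m d := by
  classical
  intro hR
  obtain ⟨n, g, _, hgen', -⟩ := id hR
  have hB : B.FG := by
    refine ⟨Finset.univ.image fun i => (g i : K), ?_⟩
    rw [Finset.coe_image, Finset.coe_univ, Set.image_univ]
    exact hgen'
  haveI := hm
  obtain ⟨ψ, hψ⟩ := exists_evalAlgHom_of_isMaximal B hB m
  have hψm := eval_eq_zero_of_mem hψ
  have hArc : ∃ a : ↥B →ₐ[k] HahnSeries ℚ k, ∀ b ∈ m, a b = 0 :=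
    ⟨(Algebra.ofId k (HahnSeries ℚ k)).comp ψ, fun b hb => by
      simp [AlgHom.comp_apply, hψm b hb]⟩
  have hdep : ∀ y : Fin (N + 1) → ↥B, ¬ AlgebraicIndependent k y := fun y hy =>
    hidden_not_algebraicIndependent N h hh hgen (fun i => (y i : K))
      (hy.map' (f := B.val) Subtype.val_injective)
  have := hidden_rtd_le B m N (d + 1) hdep hArc hR
  omega

/-- **For letters `d ≥ N` the centre is the intersection of ALL singular maximal ideals**
(`Cen(B, d) = ⋂ {m maximal : B_m not regular}`, i.e. the radical ideal of the singular locus of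
the Jacobson ring `B`): the cut condition is automatic by `hidden_cut_of_le`. [folklore] -/
theorem risoCen_cut_eq_of_le {k K : Type} [Field k] [IsAlgClosed k] [Field K] [Algebra k K]
    (N : ℕ) (h : Fin (N + 1) → K) (hh : ∀ i, h i ≠ 0)
    (hgen : IntermediateField.adjoin k
      (Set.range fun ij : Fin (N + 1) × Fin (N + 1) => h ij.1 * (h ij.2)⁻¹) = ⊤)
    (B : Subalgebra k K) {d : ℕ} (hd : N ≤ d) :
    risoCen (fun (B : Subalgebra k K) (m : Ideal ↥B) (d : ℕ) => ¬ ∃ (n : ℕ) (g : Fin n → ↥B),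
        (∀ i, g i ∈ m) ∧ Algebra.adjoin k (Set.range fun i => (g i : K)) = B ∧
        ∃ W : Submodule k (Fin n → k), d + 1 ≤ Module.finrank k ↥W ∧
        ∃ φ : {α : ↥B →ₐ[k] HahnSeries ℚ k // ∀ b ∈ m, 0 < (α b).orderTop} → (Fin n → HahnSeries ℚ k),
          (∀ a b : {α : ↥B →ₐ[k] HahnSeries ℚ k // ∀ b ∈ m, 0 < (α b).orderTop}, a ≠ b →
            ∃ j, ∀ i, (a.1 (g j) - b.1 (g j)).orderTop <
              ((φ a i - φ b i) - (a.1 (g i) - b.1 (g i))).orderTop) ∧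
          (∀ a i, 0 < (φ a i).orderTop) ∧
          (∀ a, ∀ w : Fin n → HahnSeries ℚ k, (∀ i, 0 < (w i).orderTop) →
            w ∈ Submodule.span (HahnSeries ℚ k)
              ((fun u : Fin n → k => fun i => HahnSeries.C (u i)) '' (W : Set (Fin n → k))) →
              ∃ b, φ b = φ a + w)) B d = risoCen (fun _ _ _ => True) B 0 := by
  have hS : {m : Ideal ↥B | ∃ hm : m.IsMaximal,
      ¬ IsRegularLocalRing (Localization (@Ideal.primeCompl ↥B _ m hm.isPrime)) ∧ (fun (B : Subalgebra k K) (m : Ideal ↥B) (d : ℕ) => ¬ ∃ (n : ℕ) (g : Fin n → ↥B),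
        (∀ i, g i ∈ m) ∧ Algebra.adjoin k (Set.range fun i => (g i : K)) = B ∧
        ∃ W : Submodule k (Fin n → k), d + 1 ≤ Module.finrank k ↥W ∧
        ∃ φ : {α : ↥B →ₐ[k] HahnSeries ℚ k // ∀ b ∈ m, 0 < (α b).orderTop} → (Fin n → HahnSeries ℚ k),
          (∀ a b : {α : ↥B →ₐ[k] HahnSeries ℚ k // ∀ b ∈ m, 0 < (α b).orderTop}, a ≠ b →
            ∃ j, ∀ i, (a.1 (g j) - b.1 (g j)).orderTop <
              ((φ a i - φ b i) - (a.1 (g i) - b.1 (g i))).orderTop) ∧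
          (∀ a i, 0 < (φ a i).orderTop) ∧
          (∀ a, ∀ w : Fin n → HahnSeries ℚ k, (∀ i, 0 < (w i).orderTop) →
            w ∈ Submodule.span (HahnSeries ℚ k)
              ((fun u : Fin n → k => fun i => HahnSeries.C (u i)) '' (W : Set (Fin n → k))) →
              ∃ b, φ b = φ a + w)) B m d} =
      {m : Ideal ↥B | ∃ hm : m.IsMaximal,
        ¬ IsRegularLocalRing (Localization (@Ideal.primeCompl ↥B _ m hm.isPrime)) ∧ True} := by
    ext m
    constructor
    · rintro ⟨hm, h1, -⟩
      exact ⟨hm, h1, trivial⟩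
    · rintro ⟨hm, h1, -⟩
      exact ⟨hm, h1, hidden_cut_of_le N h hh hgen B m hm hd⟩
  unfold risoCen
  rw [hS]

end Route

end Summit.ResolutionOfSingularities.ResolutionOfSingularities.Theorems

end
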